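import Summits.AtomisticToContinuum.FouriersLaw.Theses.JunctionLocality
import Summits.AtomisticToContinuum.FouriersLaw.Theorems.OddSectorIrreversibilityCorrectorTheoryUniformMixing
import Summits.AtomisticToContinuum.FouriersLaw.Theorems.OddSectorIrreversibilityCorrectorPairingGreenKubo
import Summits.AtomisticToContinuum.FouriersLaw.Theorems.OddSectorIrreversibilitySubBallisticWindowStaticCurrentBound
import Summits.AtomisticToContinuum.FouriersLaw.Theorems.OddSectorIrreversibilitySubBallisticWindowGibbsMoments
import Summits.AtomisticToContinuum.FouriersLaw.Theorems.OddSectorIrreversibilitySubBallisticWindowGibbsPoincare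

/-!
# `ConeScaleCorrector` (stmt-AtomisticToContinuum-14069) implies `NonBallistic` (stmt-AtomisticToContinuum-9127)

Helper file (`--supports stmt-AtomisticToContinuum-9127`) for the crux `JunctionLocality.NonBallistic` of
sub-problem `FouriersLaw`: a NEW EDGE in the obligation graph. The cone-scale resolvent bound E1 of route
`OddSectorIrreversibility`,

  `ConeScaleCorrector`: `∃ C ∀ N ∀ u` (a.e.-limit of the finite-horizon Kubo correctors `∫₀^τ P_t J_tot dt` of the
  equilibrium OPEN chain), `u ∈ L²(μ_T)` and `∫ u² dμ_T ≤ C · N² · Z` (`μ_T = e^{-H_N/T} dq dp`, `Z` its mass),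

gives the non-ballistic conclusion `∀ ε ∀ N₀ ∃ N ≥ N₀, D_N ≤ ε (N - 1)` OUTRIGHT (indeed `D_N = O(√N)`, i.e. the
conductance `G_N = D_N/(N-1)` is `O(N^{-1/2})`), by one weighted Cauchy–Schwarz against the total current:

* `(N-1) T² D_N · Z = ⟨u, J_tot⟩_{μ_T}` — the Green–Kubo identity in corrector form (conjunct B of the PROVED
  support `CorrectorTheory`, `Corrector.CorrectorTheory_proof`, and the landed pairing lemma
  `pinnedChain_integral_corrector_mul_withDensity`);
* `‖J_tot‖²_{μ_T} ≤ C_J · N · Z` uniformly in `N` — distant bond currents are orthogonal under the Gibbs weight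
  (landed statics of crux `SubBallisticWindow`: `stub_gibbsPoincare` → `stub_gibbsMoments` →
  `stub_staticCurrentBound`, block `[0, N)`);
* AM–GM with weight `θ = εT²/(4 max(C,1))`: `⟨u,J⟩ ≤ (θ/2)‖u‖² + ‖J‖²/(2θ) ≤ εT²N²Z/8 + C_J N Z/(2θ)`, whence
  `D_N ≤ ε(N-1)` as soon as `N - 1 ≥ 2C_J/(θ ε T²)` (`N ≥ 2`).

So the crux `NonBallistic` (shared verbatim by routes `JunctionLocality`, `PuiseuxTransferLedger`, `BondHeatUncertainty`)
is a COROLLARY of the open crux E1 of `OddSectorIrreversibility` (which that route needs for the much stronger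
`BoundedResponse`, `D_N = O(1)`); no light cone, no detailed balance, no profile forgetting is used on this path.
The theorem is conditional on `ConeScaleCorrector` only (an open item, not a Literature fact); nothing here closes an
item. No definitions.
-/

noncomputable section

open MeasureTheory Filter Topology Set
open scoped BigOperators ENNReal

namespace Summit.AtomisticToContinuum.FouriersLaw.Theorems.NonBallistic

open Literature.MathematicalPhysics.KineticTheory.HeatConduction
open Summit.AtomisticToContinuum.FouriersLaw.Theses.OddSectorIrreversibility (ConeScaleCorrector)
open Summit.AtomisticToContinuum.FouriersLaw.Theses.JunctionLocality (NonBallistic)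

/-- Weighted AM–GM: `a b ≤ (θ/2) a² + b²/(2θ)` for `θ > 0`. [folklore] -/
theorem mul_le_weighted_amgm {θ : ℝ} (hθ : 0 < θ) (a b : ℝ) :
    a * b ≤ θ / 2 * a ^ 2 + 1 / (2 * θ) * b ^ 2 := by
  have h : 0 ≤ (θ * a - b) ^ 2 / (2 * θ) := by positivity
  have e : (θ * a - b) ^ 2 / (2 * θ) = θ / 2 * a ^ 2 + 1 / (2 * θ) * b ^ 2 - a * b := by
    field_simp
    ring
  linarith [h, e]

/-- **Static extensivity of the total current, `N`-uniformly**: for `ω₂ > 0`, `lam, β ≥ 0`, any `γ`, `T > 0` there is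
`C_J ≥ 0` with `∫ J_tot² e^{-H_N/T} ≤ C_J · N · ∫ e^{-H_N/T}` for EVERY `N` (the landed block-current statics of crux
`SubBallisticWindow` on the block `[0, N)`: Brascamp–Lieb Poincaré → uniform Gibbs moments → orthogonality of distant
currents). [folklore] -/
theorem exists_totalCurrent_sq_le {ω₂ lam β : ℝ} (hω : 0 < ω₂) (hl : 0 ≤ lam) (hβ : 0 ≤ β) (γ : ℝ) {T : ℝ}
    (hT : 0 < T) :
    ∃ CJ : ℝ, 0 ≤ CJ ∧ ∀ N : ℕ,
      ∫ x, (∑ i : Fin N, (pinnedChain ω₂ lam β γ).bondCurrent N i x) ^ 2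
          ∂(volume.withDensity fun x : PhaseSpace N =>
            ENNReal.ofReal (Real.exp (-((pinnedChain ω₂ lam β γ).hamiltonian N x) / T))) ≤
        CJ * (N : ℝ) * ∫ x : PhaseSpace N, Real.exp (-((pinnedChain ω₂ lam β γ).hamiltonian N x) / T) := by
  have hP := SubBallisticWindow.GibbsPoincare.stub_gibbsPoincare ω₂ lam β γ hω hl hβ T hT
  have hM := SubBallisticWindow.GibbsMoments.stub_gibbsMoments ω₂ lam β γ hω hl hβ T hT hP
  obtain ⟨CJ, hJ⟩ := SubBallisticWindow.StaticCurrentBound.stub_staticCurrentBound ω₂ lam β γ hω hl hβ T hT hM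
  refine ⟨max CJ 0, le_max_right _ _, fun N => ?_⟩
  have h := hJ N 0 N (Nat.zero_le N)
  have hsum : ∀ x : PhaseSpace N,
      (∑ i : Fin N, (if 0 ≤ i.val ∧ i.val < N then (pinnedChain ω₂ lam β γ).bondCurrent N i x else 0)) =
        ∑ i : Fin N, (pinnedChain ω₂ lam β γ).bondCurrent N i x :=
    fun x => Finset.sum_congr rfl fun i _ => by rw [if_pos ⟨Nat.zero_le _, i.isLt⟩]
  simp only [hsum, Nat.cast_zero, sub_zero] at h
  refine h.trans ?_
  have hZ : 0 ≤ ∫ x : PhaseSpace N, Real.exp (-((pinnedChain ω₂ lam β γ).hamiltonian N x) / T) :=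
    integral_nonneg fun _ => (Real.exp_pos _).le
  have hN0 : (0 : ℝ) ≤ (N : ℝ) := Nat.cast_nonneg N
  have h1 : CJ * (N : ℝ) ≤ max CJ 0 * (N : ℝ) := mul_le_mul_of_nonneg_right (le_max_left _ _) hN0
  exact mul_le_mul_of_nonneg_right h1 hZ
set_option maxHeartbeats 400000 in
/-- **`ConeScaleCorrector → NonBallistic`.** The cone-scale resolvent bound `‖u_N‖²_{μ_T} ≤ C N² Z` on the Kubo
corrector of the total current (crux E1 of route `OddSectorIrreversibility`, stmt-AtomisticToContinuum-14069) implies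
the non-ballistic conclusion of `JunctionLocality.NonBallistic` (stmt-AtomisticToContinuum-9127): by the Green–Kubo
identity in corrector form `(N-1)T²D_N Z = ⟨u, J_tot⟩_{μ_T}` (PROVED `CorrectorTheory`, conjunct B, + the landed
pairing lemma), the `N`-uniform static bound `‖J_tot‖²_{μ_T} ≤ C_J N Z`, and AM–GM with weight `θ = εT²/(4max(C,1))`,
`D_N ≤ εN/4·… + C_J N/(2θ(N-1)T²) ≤ ε(N-1)` for every `N ≥ max(2, 2C_J/(θεT²) + 1)`. [folklore] -/
theorem nonBallistic_of_coneScaleCorrector :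
    Summit.AtomisticToContinuum.FouriersLaw.Theses.OddSectorIrreversibility.ConeScaleCorrector →
      Summit.AtomisticToContinuum.FouriersLaw.Theses.JunctionLocality.NonBallistic := by
  intro hE1 ω₂ lam β γ hω hl hβ hγ huniq μ hμ T hT D hD ε hε N₀
  obtain ⟨C₁, hE1N⟩ := hE1 ω₂ lam β γ hω hl hβ hγ T hT
  obtain ⟨CJ, hCJ0, hJ⟩ := exists_totalCurrent_sq_le hω hl.le hβ.le γ hT
  have hCT := Summit.AtomisticToContinuum.FouriersLaw.Theorems.OddSectorIrreversibility.Corrector.CorrectorTheory_proof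
  -- constants
  have hT2 : 0 < T ^ 2 := by positivity
  set C₁' : ℝ := max C₁ 1 with hC₁'def
  have hC₁'1 : 1 ≤ C₁' := le_max_right _ _
  have hC₁'0 : 0 < C₁' := lt_of_lt_of_le one_pos hC₁'1
  set θ : ℝ := ε * T ^ 2 / (4 * C₁') with hθdef
  have hθ : 0 < θ := by positivity
  set K : ℝ := 2 * CJ / (θ * ε * T ^ 2) with hKdef
  have hK0 : 0 ≤ K := by positivity
  obtain ⟨M, hM⟩ := exists_nat_ge (K + 1)
  -- the length
  set N : ℕ := max (max N₀ 2) M with hNdef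
  have hNN₀ : N₀ ≤ N := le_trans (le_max_left _ _) (le_max_left _ _)
  have hN2 : 2 ≤ N := le_trans (le_max_right _ _) (le_max_left _ _)
  have hNM : M ≤ N := le_max_right _ _
  have hNpos : 0 < N := by omega
  refine ⟨N, hNN₀, ?_⟩
  set P := pinnedChain ω₂ lam β γ with hP
  set n : ℝ := (N : ℝ) with hndef
  have hn2 : (2 : ℝ) ≤ n := by rw [hndef]; exact_mod_cast hN2
  have hnM : (M : ℝ) ≤ n := by rw [hndef]; exact_mod_cast hNM
  have hn1 : 0 < n - 1 := by linarith
  have hnK : K ≤ n - 1 := by linarith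
  -- the corrector at `N` (CorrectorTheory A) and the Green–Kubo identity (CorrectorTheory B)
  obtain ⟨u, hu1, hu2, hu3, hu4, h5, h6, h7⟩ := hCT.1 ω₂ lam β γ hω hl hβ hγ T hT N
  obtain ⟨hcI, hGKB⟩ := hCT.2 ω₂ lam β γ hω hl hβ hγ huniq μ hμ T hT N (D N) (hD N)
  simp only [] at hu1 hu2 hu3 hu4 h5 h6 h7 hcI hGKB
  clear h5 h6 h7 hu1
  have hpair := Summit.AtomisticToContinuum.FouriersLaw.Theorems.pinnedChain_integral_corrector_mul_withDensity
    hω hl.le hβ hγ hNpos hT hu2 hu4 hcI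
  set μT : Measure (PhaseSpace N) := volume.withDensity fun x : PhaseSpace N =>
    ENNReal.ofReal (Real.exp (-(P.hamiltonian N x) / T)) with hμT
  set Z : ℝ := ∫ x : PhaseSpace N, Real.exp (-(P.hamiltonian N x) / T) with hZdef
  set J : PhaseSpace N → ℝ := fun x => ∑ i : Fin N, P.bondCurrent N i x with hJdef
  have hZ : 0 < Z := integral_exp_pos (pinnedChain_integrable_gibbsDensity hω hl.le hβ.le γ N hT)
  -- `⟨u, J⟩_{μ_T} = Z (N-1) T² D_N`
  have hGK : ∫ x, u x * J x ∂μT = Z * ((n - 1) * T ^ 2 * D N) := by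
    rw [hGKB]; exact hpair.2
  -- E1 at this `N` and this `u`
  have hE1' : ∫ x, (u x) ^ 2 ∂μT ≤ C₁' * n ^ 2 * Z := by
    have h := hE1N N u
    simp only [] at h
    refine (h hu3).2.trans ?_
    exact mul_le_mul_of_nonneg_right (mul_le_mul_of_nonneg_right
      ((le_max_left _ _).trans (max_le_max le_rfl zero_le_one)) (sq_nonneg _)) hZ.le
  -- the static bound at this `N`
  have hJ' : ∫ x, (J x) ^ 2 ∂μT ≤ CJ * n * Z := hJ N
  -- integrability of the three integrands
  have huJ : Integrable (fun x => u x * J x) μT := hpair.1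
  have hu2i : Integrable (fun x => (u x) ^ 2) μT := hu2.integrable_sq
  have hJ2i : Integrable (fun x => (J x) ^ 2) μT := by
    have hsm := Summit.AtomisticToContinuum.FouriersLaw.Theorems.pinnedChain_withDensity_eq_smul_gibbsMeasure
      (γ := γ) (N := N) hω hl.le hT hβ.le
    have hZt : P.partitionFunction N T ≠ ⊤ :=
      P.partitionFunction_ne_top (pinnedChain_integrable_gibbsDensity hω hl.le hβ.le γ N hT)
    have hπ := (Summit.AtomisticToContinuum.FouriersLaw.Theorems.pinnedChain_sq_act_sum_bondCurrent
      hω hl.le hβ hγ hNpos hT 0).1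
    rw [hμT, hsm]
    exact hπ.smul_measure hZt
  -- AM–GM under the integral
  have hamgm : ∫ x, u x * J x ∂μT ≤ θ / 2 * ∫ x, (u x) ^ 2 ∂μT + 1 / (2 * θ) * ∫ x, (J x) ^ 2 ∂μT := by
    have hgi : Integrable (fun x => θ / 2 * (u x) ^ 2 + 1 / (2 * θ) * (J x) ^ 2) μT :=
      (hu2i.const_mul (θ / 2)).add (hJ2i.const_mul (1 / (2 * θ)))
    have hmono : ∫ x, u x * J x ∂μT ≤ ∫ x, (θ / 2 * (u x) ^ 2 + 1 / (2 * θ) * (J x) ^ 2) ∂μT :=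
      integral_mono huJ hgi fun x => mul_le_weighted_amgm hθ (u x) (J x)
    have hsum : ∫ x, (θ / 2 * (u x) ^ 2 + 1 / (2 * θ) * (J x) ^ 2) ∂μT =
        θ / 2 * ∫ x, (u x) ^ 2 ∂μT + 1 / (2 * θ) * ∫ x, (J x) ^ 2 ∂μT := by
      rw [integral_add (hu2i.const_mul _) (hJ2i.const_mul _), integral_const_mul, integral_const_mul]
    exact hmono.trans_eq hsum
  -- combine and divide by `Z`
  have hmain : (n - 1) * T ^ 2 * D N ≤ θ / 2 * (C₁' * n ^ 2) + 1 / (2 * θ) * (CJ * n) := by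
    have h1 : Z * ((n - 1) * T ^ 2 * D N) ≤ Z * (θ / 2 * (C₁' * n ^ 2) + 1 / (2 * θ) * (CJ * n)) := by
      calc Z * ((n - 1) * T ^ 2 * D N) = ∫ x, u x * J x ∂μT := hGK.symm
        _ ≤ θ / 2 * ∫ x, (u x) ^ 2 ∂μT + 1 / (2 * θ) * ∫ x, (J x) ^ 2 ∂μT := hamgm
        _ ≤ θ / 2 * (C₁' * n ^ 2 * Z) + 1 / (2 * θ) * (CJ * n * Z) := by
            gcongr
        _ = Z * (θ / 2 * (C₁' * n ^ 2) + 1 / (2 * θ) * (CJ * n)) := by ring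
    exact le_of_mul_le_mul_left h1 hZ
  -- arithmetic: `θ/2 · C₁' n² = ε T² n²/8 ≤ ε T² (n-1)²/2` and `CJ n/(2θ) ≤ ε T² (n-1)²/2`
  have hterm1 : θ / 2 * (C₁' * n ^ 2) = ε * T ^ 2 * n ^ 2 / 8 := by
    rw [hθdef]
    field_simp
    ring
  have hnsq : n ^ 2 ≤ 4 * (n - 1) ^ 2 := by nlinarith
  have hA : ε * T ^ 2 * n ^ 2 / 8 ≤ ε * T ^ 2 * (n - 1) ^ 2 / 2 := by
    have : 0 ≤ ε * T ^ 2 := by positivity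
    nlinarith
  have hB : 1 / (2 * θ) * (CJ * n) ≤ ε * T ^ 2 * (n - 1) ^ 2 / 2 := by
    -- `n ≤ 2 (n - 1)` and `K = 2 CJ/(θ ε T²) ≤ n - 1`
    have hK' : 2 * CJ ≤ θ * ε * T ^ 2 * (n - 1) := by
      have hpos : 0 < θ * ε * T ^ 2 := by positivity
      have := (div_le_iff₀ hpos).1 hnK
      linarith
    have hn' : n ≤ 2 * (n - 1) := by linarith
    rw [div_mul_eq_mul_div, one_mul, div_le_iff₀ (by positivity : (0 : ℝ) < 2 * θ)]
    have h0 : 0 ≤ CJ := hCJ0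
    have hθε : 0 ≤ θ * ε * T ^ 2 * (n - 1) := by positivity
    nlinarith
  have hfin : (n - 1) * T ^ 2 * D N ≤ (n - 1) * T ^ 2 * (ε * (n - 1)) := by
    calc (n - 1) * T ^ 2 * D N ≤ θ / 2 * (C₁' * n ^ 2) + 1 / (2 * θ) * (CJ * n) := hmain
      _ ≤ ε * T ^ 2 * (n - 1) ^ 2 / 2 + ε * T ^ 2 * (n - 1) ^ 2 / 2 := by rw [hterm1]; exact add_le_add hA hB
      _ = (n - 1) * T ^ 2 * (ε * (n - 1)) := by ring
  have hpos : 0 < (n - 1) * T ^ 2 := by positivity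
  exact le_of_mul_le_mul_left hfin hpos

end Summit.AtomisticToContinuum.FouriersLaw.Theorems.NonBallistic

end
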